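import Summits.BirchSwinnertonDyer.Rank1Residual.X11b.BDPRouteNoRam
import Literature.NumberTheory.EllipticCurves.LocalTorsionAdditiveReductionPPrimaryProofs
import Literature.NumberTheory.EllipticCurves.NeronIsogenyScalingHoldsProofs
import HarnessLib

/-!
# Route `ErratumRoadFive`, crux `EulerHalfNotRamNoInertSetAtFive` (item stmt-BirchSwinnertonDyer-19715) — ROAD J, generic part:
# Kolyvagin's Tamagawa defect on the classical Heegner frame SHARPENED BY A JETCHEV TERM AT THE PAIR'S OWN PRIME `p`
# (displayed binder), and the Tamagawa product of a curve whose only multiplicative prime is `p`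

Cell `bsd-stepL`, seat `bsd-line-er5-p1-w2` (D-0154 width seat -w2 on crux 19715; lead `bsd-line-er5-p1` g0 GO 06:31Z on «road J»),
`--supports stmt-BirchSwinnertonDyer-19715`. THEOREMS ONLY (no definition, no named fact, no `sorry`).

WHAT. The classical ¬(ram) road of the kernel (`X11b/BDPRouteNoRam.lean`, `AdditivePotMult/RankOneHeegnerAnyPrime.lean`): for a rank-one pair
`(E, p)`, `p ≥ 5`, `ρ̄` onto, a Heegner field `K` for `N_E` with `p` split and `L(E^{d_K},1) ≠ 0` (Friedberg–Hoffstein), Kolyvagin's bound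
`ord_p #Ш(E/K) ≤ 2·ord_p [E(K):ℤy_K]` and the Gross–Zagier ∕ BSD bookkeeping give `ord_p #Ш(E) ≤ ord_p #Ш(E)_an + 2·ord_p ∏_ℓ c_ℓ(E)` modulo the
lower half of the twist (`X11b.padicValNat_shaOrder_le_add_of_shaIndexBound`): the DEFECT `2·ord_p ∏c` is Kolyvagin's, and Jetchev 2008 (Cor. 1.5,
printed under Hypothesis (∗): `p ∤ N`, `ρ̄` onto) removes from it `2·ord_p c_q` for ONE prime `q ∣ N`. On crux 19715's piece S1b (`p` the ONLY
multiplicative prime, split, `p ∣ ord_pΔ_min = c_p`) the defect is EXACTLY `2·ord_p c_p(E)` (additive `c_ℓ ≤ 4 < p`), so a Jetchev term AT `q := p`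
would cancel it — but `q = p ∥ N` is outside Jetchev's print (`p ∤ N`) and Miller 2011 Thm. 5.4 states only the `ℚ`-form (tree fact
`Miller2011.thm54_surj_padicValNat_shaOrder_add_tamagawa_le`, reading flag JET@p∣N, sub-flag B «q = p»). THIS FILE types the `K`-form at `q = p` as a
DISPLAYED binder and runs the bookkeeping with it:

* `padicValNat_shaOrder_add_le_of_shaIndexBoundSlack` — the engine `X11b.padicValNat_shaOrder_le_add_of_shaIndexBound` with a slack `s` carried from
  the `K`-bound to the conclusion: `ord_p #Ш(E/K) + s ≤ 2·ord_p I ⟹ ord_p #Ш(E) + s ≤ ord_p q + 2·ord_p ∏c(E)` (same `omega`).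
  -- adapted from Summits/BirchSwinnertonDyer/Rank1Residual/X11b/BDPRouteTamagawaDefect.lean
* `padicValNat_tamagawaProduct_le_of_onlyMult` — if `p ≥ 5` and every multiplicative prime of `E` equals `p`, then
  `ord_p ∏_ℓ c_ℓ(E) ≤ ord_p c_p(E)` (Kodaira–Néron: `c_ℓ ≤ 4` off the multiplicative primes, tree `localTamagawaNumber_padic_le_four_of_not_mult`).
* `padicValNat_shaOrder_add_le_of_rankOne_of_lowerTwists_of_jetchevAtP` — class level (shape of
  `AdditivePotMult.padicValNat_shaOrder_le_add_of_rankOne_of_lowerTwists_of_not_sq_dvd`, Kolyvagin's `hB` replaced by the displayed `hJ`):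
  `ord_p #Ш(E) + 2·ord_p c_p(E) ≤ ord_p #Ш(E)_an + 2·ord_p ∏c(E)` for rank one, `p ≥ 5` multiplicative, `E[p]` irreducible, `ρ̄` onto, modulo the
  rank-zero twists' lower halves.
  -- adapted from Summits/BirchSwinnertonDyer/Rank1Residual/AdditivePotMult/RankOneHeegnerAnyPrime.lean
* `missingUpperBoundAt_of_onlyMult_of_lowerTwists_of_jetchevAtP` — hence `Typed.MissingUpperBoundAt W p` when `p` is the only multiplicative prime.

THE DISPLAYED BINDER `hJ` («Jetchev at the pair's own prime», K-form), in the shape of the tree's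
`Literature.NumberTheory.EllipticCurves.Kolyvagin1990_padicValNat_card_sha_le` with Jetchev's Tamagawa term at `q := p` and the guard `p ∣ N`:
for a Heegner point `P` of infinite order of any parametrisation datum at level `N`, `p` odd, `ρ̄_{E,p}` onto, `p ∣ N`:
`ord_p #Ш(E/K) + 2·ord_p c_p(E) ≤ 2·ord_p [E(K):ℤP]`. STATUS: NOT IN PRINT. Jetchev 2008 Thm. 1.1 = Cor. 1.5 proves it for `q ∣ N` under
Hypothesis (∗) `p ∤ N` [cite: Jetchev2008, Hypothesis (*), Thm. 1.4, Cor. 1.5 (arXiv p. 3) = printed Thm. 1.1 (p. 812)]; Miller 2011 Thm. 5.4 states the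
`ℚ`-form `ord_p #Ш(E/ℚ) ≤ 2(ord_p I_K − max_q ord_p c_q)` with no `p`-versus-`N` clause and applies it at `p ∣ N` [cite: Miller2011LMS, Thm. 5.4 (p. 11)];
the lane's reading (LEAD-MEMO-JET-localconditions) locates the one `p`-versus-place step of Jetchev's proof at his Lemma 4.3 («v ∤ p»). The honest
reason the step is open at a split multiplicative `p` with `p ∣ c_p`: the local group `E(ℚ_p)` may then carry `p`-torsion from the component group
(the territory of Castella's erratum condition (iv) ∕ Skinner–Zhang's hypothesis (b)), which the local analysis at `v ∣ p` of the derived Kolyvagin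
classes must control. `hJ` is implied by BSD(E/K)_p (the predicted `ord_p #Ш(E/K) = 2·ord_p I − 2·Σ_q ord_p c_q(E)`), so no pair can refute it
against BSD; it is typed here as a hypothesis, asserted nowhere.

HONEST FRAMING: CONDITIONAL on `hJ` (beyond print as said), on the lower halves of the rank-zero twists (open crux `X11aLowerHalf` on X11b's ¬(ram)
locus) and on the PUBLISHED facts `hGZ`, `hKo`, `hGZK`, `hmod`, `hnf`, `hFH`, `hMaz`; nothing is booked; no census label moves (T7); BSD is not
proved for any curve by any of this.
-/

noncomputable section

open scoped Classical NumberField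

open WeierstrassCurve NumberField IsDedekindDomain Rat.HeightOneSpectrum
  Literature.NumberTheory.EllipticCurves
  Literature.NumberTheory.EllipticCurves.ModularForms
  Literature.NumberTheory.EllipticCurves.Rank1Residual
  Literature.NumberTheory.EllipticCurves.Rank1Residual.Typed
  Literature.NumberTheory.EllipticCurves.KrizLi2019
  Literature.NumberTheory.Automorphic
  Summit.BirchSwinnertonDyer.Rank1Residual Summit.BirchSwinnertonDyer.Rank1Residual.X11b

-- the cell's Theorems namespace repeats the summit name (Summit.<Summit>.<Problem>), as in every sibling file
set_option linter.dupNamespace false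

namespace Summit.BirchSwinnertonDyer.BirchSwinnertonDyer.Theorems.JetchevAtP

/-! ### §1 The bookkeeping engine with a slack carried from the `K`-bound -/

/-- **Kolyvagin's Tamagawa defect at Heegner data, with a slack `s`.** Exactly `X11b.padicValNat_shaOrder_le_add_of_shaIndexBound`
(Gross–Zagier ∕ BSD bookkeeping `exists_shaAn_padicVal_eq_of_heegner` + the twist's `≥`-half + a `K`-bound), the `K`-bound now carrying an extra
term `s` on the left (`ord_p #Ш(E/K) + s ≤ 2·ord_p [E(K):ℤP]`), which reappears in the conclusion:
`ord_p #Ш(E) + s ≤ ord_p q + 2·ord_p ∏_ℓ c_ℓ(E)` with `#Ш(E)_an = q`. Arithmetic: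
`v(Ш_W) + v(Ш_d) + s = v(Ш_K) + s ≤ 2v(I) = v(q) + v(q_d) + v(c_W) + 2v(t_d) ≤ v(q) + v(Ш_d) + v(c_d) + v(c_W)`. NO typed input.
[cite: JetchevSkinnerWan2017, §7.4.2 (p. 31)] [cite: McCallumLMS1991, §1 Theorem (Kolyvagin), p. 296] [cite: Miller2011LMS, Def. 1.1] -/
theorem padicValNat_shaOrder_add_le_of_shaIndexBoundSlack
    (W : WeierstrassCurve ℚ) [W.IsElliptic] [W.IsGloballyMinimal] (p : ℕ) [Fact p.Prime]
    (N : ℕ) [NeZero N] (K : Type) [Field K] [NumberField K]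
    (Dt : ModularParametrizationData W N) (H : HeegnerDatum N (NumberField.discr K)) (ι : K →+* ℂ)
    (P : (W.baseChange K).toAffine.Point)
    (hGZ : gross_zagier N W K) (hKo : kolyvagin N W K)
    (hGZK : rank_eq_analyticRank_of_analyticRank_le_one) (hmod : hasEntireLFunction_rat)
    (hK : IsImaginaryQuadratic K) (hHN : SatisfiesHeegnerHypothesis N K)
    (hP : WeierstrassCurve.Affine.Point.map ι.toRatAlgHom P = heegnerPointComplex Dt H)
    (hp2 : p ≠ 2) (hc : ¬ (p : ℤ) ∣ Dt.c) (hμ : ¬ p ∣ Units.torsionOrder K)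
    (hr : W.analyticRank = 1)
    (hLt : (W.quadraticTwist (NumberField.discr K : ℚ)).entireLFunction 1 ≠ 0)
    (Wd : WeierstrassCurve ℚ) [Wd.IsElliptic] [Wd.IsGloballyMinimal] (Cd : VariableChange ℚ)
    (hWd : Cd • W.quadraticTwist (NumberField.discr K : ℚ) = Wd)
    (hu : padicValRat p (Cd.u : ℚ) = 0)
    (htam : padicValNat p Wd.tamagawaProduct = padicValNat p W.tamagawaProduct)
    (htw : ∃ q : ℚ, Wd.entireLFunction 1 / (Wd.realPeriodRat : ℂ) = (q : ℂ) ∧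
      padicValRat p q ≤ (padicValNat p Wd.shaOrder : ℤ) + padicValNat p Wd.tamagawaProduct -
        2 * padicValNat p Wd.torsionOrder)
    -- a `K`-bound of Kolyvagin's shape with a slack `s`
    (s : ℕ)
    (hU : Finite (W.baseChange K).sha → ¬ IsOfFinAddOrder P →
      padicValNat p (Nat.card (W.baseChange K).sha) + s ≤
        2 * padicValNat p (AddSubgroup.zmultiples P).index) :
    ∃ q : ℚ, shaAn W = (q : ℂ) ∧
      (padicValNat p W.shaOrder : ℤ) + s ≤ padicValRat p q + 2 * padicValNat p W.tamagawaProduct := by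
  -- adapted from Summits/BirchSwinnertonDyer/Rank1Residual/X11b/BDPRouteTamagawaDefect.lean
  obtain ⟨qd, hqd, hvqd⟩ := htw
  obtain ⟨-, hfinK, hsha, q, hq, hval⟩ := exists_shaAn_padicVal_eq_of_heegner W p N K Dt H ι P
    hGZ hKo hGZK hmod hK hHN hP hp2 hc hμ hr hLt Wd Cd hWd hu qd hqd
  have hL0 : W.entireLFunction 1 = 0 := entireLFunction_one_eq_zero_of_analyticRank_eq_one hr
  obtain ⟨-, hderiv⟩ := leadingLCoeff_eq_deriv_of_analyticRank_eq_one hr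
  have hLK : LDerivEK W K ≠ 0 := by
    rw [lDerivEK_eq_deriv_mul W K hmod hL0]; exact mul_ne_zero hderiv hLt
  have hPinf : ¬ IsOfFinAddOrder P :=
    (lDerivEK_ne_zero_iff_not_isOfFinAddOrder W N K hGZ hK hHN ⟨Dt, H, ι, hP⟩).mp hLK
  have hKU : padicValNat p (W.baseChange K).shaOrder + s ≤
      2 * padicValNat p (AddSubgroup.zmultiples P).index := hU hfinK hPinf
  refine ⟨q, hq, ?_⟩
  have e1 : (padicValNat p (W.baseChange K).shaOrder : ℤ) + s ≤
      2 * padicValNat p (AddSubgroup.zmultiples P).index := by exact_mod_cast hKU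
  have e2 : (padicValNat p (W.baseChange K).shaOrder : ℤ) =
      padicValNat p W.shaOrder + padicValNat p Wd.shaOrder := by exact_mod_cast hsha
  have e3 : (padicValNat p Wd.tamagawaProduct : ℤ) = padicValNat p W.tamagawaProduct := by
    exact_mod_cast htam
  omega

/-! ### §2 The Tamagawa product when `p` is the only multiplicative prime -/

/-- `ord_p` of a finite product of non-zero naturals is the sum of the `ord_p`. [folklore] -/
private theorem padicValNat_finset_prod (p : ℕ) [Fact p.Prime] {ι : Type*} (s : Finset ι)
    (f : ι → ℕ) (hf : ∀ i ∈ s, f i ≠ 0) :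
    padicValNat p (∏ i ∈ s, f i) = ∑ i ∈ s, padicValNat p (f i) := by
  induction s using Finset.induction_on with
  | empty => simp
  | insert a s ha ih =>
    rw [Finset.prod_insert ha, Finset.sum_insert ha,
      padicValNat.mul (hf a (Finset.mem_insert_self a s))
        (Finset.prod_ne_zero_iff.mpr fun i hi => hf i (Finset.mem_insert_of_mem hi)),
      ih fun i hi => hf i (Finset.mem_insert_of_mem hi)]

/-- **`ord_p ∏_ℓ c_ℓ(E) ≤ ord_p c_p(E)` when `p ≥ 5` and every multiplicative prime of `E` equals `p`.** The Tamagawa product is the finite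
product of the local factors over the bad places (`tamagawaProduct_eq_prod`); at a place `ℓ ≠ p` the curve is not multiplicative, so `c_ℓ ≤ 4 < p`
(Kodaira–Néron, tree `localTamagawaNumber_padic_le_four_of_not_mult`) and `ord_p c_ℓ = 0`; the place `p` contributes `ord_p c_p`.
[cite: SilvermanAEC2009, Thm VII.6.1] [cite: SilvermanATAEC1994, Cor. IV.9.2(d)] -/
theorem padicValNat_tamagawaProduct_le_of_onlyMult
    (W : WeierstrassCurve ℚ) [W.IsElliptic] [W.IsGloballyMinimal] (p : ℕ) [Fact p.Prime] (hp5 : 5 ≤ p)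
    (honly : ∀ (ℓ : ℕ) [Fact ℓ.Prime], W.HasMultiplicativeReductionAtPrime ℓ → ℓ = p) :
    padicValNat p W.tamagawaProduct ≤ padicValNat p ((W.baseChange ℚ_[p]).localTamagawaNumber ℤ_[p]) := by
  have hp : p.Prime := Fact.out
  have hfW : (W.badPlaces ℤ).Finite := W.finite_badPlaces_holds ℤ
  set s : Finset (HeightOneSpectrum ℤ) := hfW.toFinset with hs
  have hsW : ∀ v, ¬ W.HasGoodReductionAt v → v ∈ s := fun v hv ↦ by
    rw [hs, Set.Finite.mem_toFinset, mem_badPlaces_iff]; exact hv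
  set f : HeightOneSpectrum ℤ → ℕ := fun v ↦
    haveI := Fact.mk (primesEquiv v).2
    padicValNat p ((W.baseChange ℚ_[primesEquiv v]).localTamagawaNumber ℤ_[primesEquiv v]) with hf
  -- termwise: only the place over `p` can contribute
  have hterm : ∀ v : HeightOneSpectrum ℤ,
      f v ≤ if (primesEquiv v : ℕ) = p then padicValNat p ((W.baseChange ℚ_[p]).localTamagawaNumber ℤ_[p]) else 0 := by
    intro v
    haveI := Fact.mk (primesEquiv v).2
    have key : ∀ (q : ℕ) (hq : Fact q.Prime), (primesEquiv v : ℕ) = q →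
        padicValNat p (@WeierstrassCurve.localTamagawaNumber ℤ_[q] _ _ _ ℚ_[q] _ _ _ (W.baseChange ℚ_[q])) ≤
          if q = p then padicValNat p ((W.baseChange ℚ_[p]).localTamagawaNumber ℤ_[p]) else 0 := by
      rintro q hq hvq
      by_cases hqp : q = p
      · subst hqp
        simp
      · rw [if_neg hqp, Nat.le_zero]
        have hnm : ¬ W.HasMultiplicativeReductionAtPrime q := fun hm ↦ hqp (honly q hm)
        have hle : (W.baseChange ℚ_[q]).localTamagawaNumber ℤ_[q] ≤ 4 :=
          localTamagawaNumber_padic_le_four_of_not_mult W q hnm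
        apply padicValNat.eq_zero_of_not_dvd
        intro hdvd
        haveI : (W.baseChange ℚ_[q]).IsElliptic := inferInstanceAs (W.map (algebraMap ℚ ℚ_[q])).IsElliptic
        have hne : (W.baseChange ℚ_[q]).localTamagawaNumber ℤ_[q] ≠ 0 := localTamagawaNumber_padic_ne_zero_holds q _
        have := Nat.le_of_dvd (Nat.pos_of_ne_zero hne) hdvd
        omega
    exact key _ _ rfl
  rw [tamagawaProduct_eq_prod W s hsW, padicValNat_finset_prod p s _ fun v _ ↦ ?_]
  · calc ∑ v ∈ s, f v
        ≤ ∑ v ∈ s, (if (primesEquiv v : ℕ) = p then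
            padicValNat p ((W.baseChange ℚ_[p]).localTamagawaNumber ℤ_[p]) else 0) :=
          Finset.sum_le_sum fun v _ ↦ hterm v
      _ = ∑ ℓ ∈ s.image (fun v ↦ (primesEquiv v : ℕ)),
            (if ℓ = p then padicValNat p ((W.baseChange ℚ_[p]).localTamagawaNumber ℤ_[p]) else 0) := by
          rw [Finset.sum_image]
          intro v _ w _ h
          exact primesEquiv.injective (Subtype.ext h)
      _ ≤ padicValNat p ((W.baseChange ℚ_[p]).localTamagawaNumber ℤ_[p]) := by
          rw [Finset.sum_ite_eq']
          split_ifs <;> simp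
  · haveI := Fact.mk (primesEquiv v).2
    haveI : (W.baseChange ℚ_[primesEquiv v]).IsElliptic :=
      inferInstanceAs (W.map (algebraMap ℚ ℚ_[primesEquiv v])).IsElliptic
    exact localTamagawaNumber_padic_ne_zero_holds (primesEquiv v) _

/-! ### §3 Class level: Kolyvagin's defect minus the Jetchev term at `p`, modulo the rank-zero twists' lower halves -/

/-- **Rank one, `p ≥ 5` multiplicative with `E[p]` irreducible and `ρ̄` onto: Kolyvagin's Tamagawa defect with the Jetchev term at the pair's own
prime removed, modulo the rank-zero Heegner twists' lower halves and the DISPLAYED binder `hJ`** («Jetchev at `q := p ∥ N`», K-form; NOT in print —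
module docstring): `#Ш(E)_an = q ∈ ℚ` with `ord_p #Ш(E) + 2·ord_p c_p(E) ≤ ord_p q + 2·ord_p ∏_ℓ c_ℓ(E)`. Shape and proof of
`AdditivePotMult.padicValNat_shaOrder_le_add_of_rankOne_of_lowerTwists(_of_not_sq_dvd)` with Kolyvagin's `hB` replaced by `hJ` and the engine by
its slack twin; the Manin-unit datum with `p ∤ c` exists since `p² ∤ N` (`X11b.exists_modularParametrizationData_not_dvd`). Published binders `hGZ`, `hKo`,
`hGZK`, `hmod`, `hnf`, `hFH`, `hMaz`; the Néron scaling is the tree theorem `integral_neronScaling_of_isGloballyMinimal_holds`. CONDITIONAL; nothing booked.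
[cite: Jetchev2008, Cor. 1.5 (arXiv p. 3) — printed under Hyp. (*) p ∤ N; taken here at q := p ∥ N: NOT in print]
[cite: Miller2011LMS, Thm. 5.4 (p. 11) and Def. 1.1] [cite: McCallumLMS1991, §1 Theorem (Kolyvagin), p. 296] [cite: Mazur1978, Cor. 4.1] -/
theorem padicValNat_shaOrder_add_le_of_rankOne_of_lowerTwists_of_jetchevAtP
    (hGZ : ∀ (N : ℕ) [NeZero N] (W : WeierstrassCurve ℚ) (K : Type) [Field K] [NumberField K],
      gross_zagier N W K)
    (hKo : ∀ (N : ℕ) [NeZero N] (W : WeierstrassCurve ℚ) (K : Type) [Field K] [NumberField K],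
      kolyvagin N W K)
    (hGZK : rank_eq_analyticRank_of_analyticRank_le_one) (hmod : hasEntireLFunction_rat)
    (hnf : exists_isNewformOf) (hFH : friedbergHoffstein_exists_heegnerField_split_twist_ne_zero)
    (hMaz : mazur_not_dvd_maninConstant_of_odd)
    -- the DISPLAYED binder: Jetchev's `K`-bound with the Tamagawa term at `q := p ∣ N` (NOT in print at `p ∣ N`)
    (hJ : ∀ (N : ℕ) [NeZero N] (W : WeierstrassCurve ℚ) (K : Type) [Field K] [NumberField K] [W.IsElliptic],
      IsImaginaryQuadratic K → SatisfiesHeegnerHypothesis N K →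
      ∀ {P : (W.baseChange K).toAffine.Point}, IsHeegnerPoint N W K P → ¬ IsOfFinAddOrder P →
      ∀ {p : ℕ} [Fact p.Prime], p ≠ 2 → W.HasSurjectiveModNGaloisRep p → p ∣ N →
        padicValNat p (Nat.card (W.baseChange K).sha) +
            2 * padicValNat p ((W.baseChange ℚ_[p]).localTamagawaNumber ℤ_[p]) ≤
          2 * padicValNat p (AddSubgroup.zmultiples P).index)
    (W : WeierstrassCurve ℚ) [W.IsElliptic] [W.IsGloballyMinimal] (p : ℕ) [Fact p.Prime]
    [NeZero (W.conductorNorm ℤ)]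
    (hmult : Mult W p) (hirr : Irr W p) (hsurj : Surj W p) (hp5 : 5 ≤ p) (hr : W.analyticRank = 1)
    (hlow : ∀ (K : Type) [Field K] [NumberField K] (Wd : WeierstrassCurve ℚ) [Wd.IsElliptic]
      [Wd.IsGloballyMinimal], IsImaginaryQuadratic K →
      SatisfiesHeegnerHypothesis (W.conductorNorm ℤ) K → SatisfiesHeegnerHypothesis p K →
      (∃ C : VariableChange ℚ, C • W.quadraticTwist (NumberField.discr K : ℚ) = Wd) →
      Wd.analyticRank = 0 → MissingLowerBoundAt Wd p) :
    ∃ q : ℚ, shaAn W = (q : ℂ) ∧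
      (padicValNat p W.shaOrder : ℤ) + 2 * padicValNat p ((W.baseChange ℚ_[p]).localTamagawaNumber ℤ_[p]) ≤
        padicValRat p q + 2 * padicValNat p W.tamagawaProduct := by
  -- adapted from Summits/BirchSwinnertonDyer/Rank1Residual/AdditivePotMult/RankOneHeegnerAnyPrime.lean
  have hNS : integral_neronScaling_of_isGloballyMinimal := integral_neronScaling_of_isGloballyMinimal_holds
  have hp : p.Prime := Fact.out
  have hp2 : p ≠ 2 := by omega
  have hpN : p ∣ W.conductorNorm ℤ :=
    (W.dvd_conductorNorm_iff_not_hasGoodReductionAtPrime p).mpr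
      (WeierstrassCurve.HasMultiplicativeReduction.not_hasGoodReduction (R := ℤ_[p]) hmult)
  have hpN2 : ¬ p ^ 2 ∣ W.conductorNorm ℤ := not_sq_dvd_conductorNorm_of_mult W p hmult
  obtain ⟨D, hc⟩ := X11b.exists_modularParametrizationData_not_dvd hnf hMaz hNS W rfl hp hp2 hpN2 hirr
  have hw : W.rootNumber = -1 := by
    rw [WeierstrassCurve.rootNumber_eq_neg_one_pow_analyticRank_of_exists_isNewformOf hnf W, hr]
    norm_num
  obtain ⟨K, _, _, hK, hdisc, hHN, hHp, hLt⟩ := hFH W hw p hp 4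
  have hμ : ¬ p ∣ Units.torsionOrder K := by
    haveI : IsTotallyComplex K := hK.2
    have hneg : NumberField.discr K < 0 := discr_neg_of_finrank_eq_two K hK.1
    have habs : ((NumberField.discr K).natAbs : ℤ) = -NumberField.discr K :=
      Int.ofNat_natAbs_of_nonpos hneg.le
    have h4 : NumberField.discr K < -4 := by
      have : (4 : ℤ) < ((NumberField.discr K).natAbs : ℤ) := by exact_mod_cast hdisc
      omega
    rw [Literature.NumberTheory.DiophantineGeometry.torsionOrder_eq_two_of_discr_lt hK.1 h4]
    intro h2
    have := Nat.le_of_dvd two_pos h2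
    omega
  obtain ⟨β, hβ⟩ := exists_dvd_sq_sub_discr_holds (W.conductorNorm ℤ) K hK hHN
  obtain ⟨H, -⟩ := nonempty_heegnerDatum_holds (W.conductorNorm ℤ) K hK hβ
  obtain ⟨ι⟩ : Nonempty (K →+* ℂ) := inferInstance
  obtain ⟨P, hP⟩ := heegnerPointComplex_mem_range_map_holds (W.conductorNorm ℤ) W K hK hHN D H ι
  have hD0 : (NumberField.discr K : ℚ) ≠ 0 := by exact_mod_cast NumberField.discr_ne_zero K
  haveI hEt : (W.quadraticTwist (NumberField.discr K : ℚ)).IsElliptic :=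
    W.isElliptic_quadraticTwist hD0
  obtain ⟨Cd, hCd⟩ := hasGlobalMinimalModel_rat_holds (W.quadraticTwist (NumberField.discr K : ℚ))
  haveI : (Cd • W.quadraticTwist (NumberField.discr K : ℚ)).IsGloballyMinimal := hCd
  set Wd : WeierstrassCurve ℚ := Cd • W.quadraticTwist (NumberField.discr K : ℚ) with hWd_def
  have hWd : Cd • W.quadraticTwist (NumberField.discr K : ℚ) = Wd := rfl
  have hrd : Wd.analyticRank = 0 := by
    rw [hWd_def, analyticRank_smul]
    exact analyticRank_eq_zero_of_entireLFunction_one_ne_zero _ hLt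
  have hlowd : MissingLowerBoundAt Wd p := hlow K Wd hK hHN hHp ⟨Cd, rfl⟩ hrd
  -- transports to the twist model
  have hirrd : Wd.HasIrreducibleModPGaloisRep p :=
    X11b.hasIrreducibleModPGaloisRep_twist_model W p K hK.1 hirr Cd hWd
  have htam : padicValNat p Wd.tamagawaProduct = padicValNat p W.tamagawaProduct :=
    X11b.padicValNat_tamagawaProduct_twist_of_heegner W p hp5 K hK hHN Cd hWd
  have hu : padicValRat p (Cd.u : ℚ) = 0 :=
    AdditivePotMult.padicValRat_u_eq_zero_of_twist_minimal_of_split W p K hK hHp Cd hWd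
  obtain ⟨qd, hqd, hvqd⟩ :=
    AdditivePotMult.exists_printShape_lower_of_missingLowerBoundAt_rankZero (p := p) Wd hGZK hrd hirrd hlowd
  exact padicValNat_shaOrder_add_le_of_shaIndexBoundSlack W p (W.conductorNorm ℤ) K D H ι P (hGZ _ W K)
    (hKo _ W K) hGZK hmod hK hHN hP hp2 hc hμ hr hLt Wd Cd hWd hu htam ⟨qd, hqd, hvqd⟩ _
    (fun _ hnt ↦ hJ _ W K hK hHN ⟨D, H, ι, hP⟩ hnt hp2 hsurj hpN)

/-- **The Euler-system half on «`p` the ONLY multiplicative prime» (rank one, `p ≥ 5`, `E[p]` irreducible, `ρ̄` onto), modulo the rank-zero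
twists' lower halves and the displayed binder `hJ`**: then `ord_p ∏_ℓ c_ℓ(E) ≤ ord_p c_p(E)` (`padicValNat_tamagawaProduct_le_of_onlyMult`), so the
sharpened defect inequality reads `ord_p #Ш(E) ≤ ord_p #Ш(E)_an`, i.e. `Typed.MissingUpperBoundAt W p`. CONDITIONAL (hJ NOT in print; the twists'
halves = crux `X11aLowerHalf` on the ¬(ram) locus); nothing booked; no BSD case is proved.
[cite: Jetchev2008, Cor. 1.5 (arXiv p. 3) — printed under Hyp. (*) p ∤ N; taken here at q := p ∥ N: NOT in print]
[cite: Miller2011LMS, Thm. 5.4 (p. 11) and Def. 1.1] [cite: SilvermanAEC2009, Thm VII.6.1] -/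
theorem missingUpperBoundAt_of_onlyMult_of_lowerTwists_of_jetchevAtP
    (hGZ : ∀ (N : ℕ) [NeZero N] (W : WeierstrassCurve ℚ) (K : Type) [Field K] [NumberField K],
      gross_zagier N W K)
    (hKo : ∀ (N : ℕ) [NeZero N] (W : WeierstrassCurve ℚ) (K : Type) [Field K] [NumberField K],
      kolyvagin N W K)
    (hGZK : rank_eq_analyticRank_of_analyticRank_le_one) (hmod : hasEntireLFunction_rat)
    (hnf : exists_isNewformOf) (hFH : friedbergHoffstein_exists_heegnerField_split_twist_ne_zero)
    (hMaz : mazur_not_dvd_maninConstant_of_odd)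
    (hJ : ∀ (N : ℕ) [NeZero N] (W : WeierstrassCurve ℚ) (K : Type) [Field K] [NumberField K] [W.IsElliptic],
      IsImaginaryQuadratic K → SatisfiesHeegnerHypothesis N K →
      ∀ {P : (W.baseChange K).toAffine.Point}, IsHeegnerPoint N W K P → ¬ IsOfFinAddOrder P →
      ∀ {p : ℕ} [Fact p.Prime], p ≠ 2 → W.HasSurjectiveModNGaloisRep p → p ∣ N →
        padicValNat p (Nat.card (W.baseChange K).sha) +
            2 * padicValNat p ((W.baseChange ℚ_[p]).localTamagawaNumber ℤ_[p]) ≤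
          2 * padicValNat p (AddSubgroup.zmultiples P).index)
    (W : WeierstrassCurve ℚ) [W.IsElliptic] [W.IsGloballyMinimal] (p : ℕ) [Fact p.Prime]
    (hmult : Mult W p) (hirr : Irr W p) (hsurj : Surj W p) (hp5 : 5 ≤ p) (hr : W.analyticRank = 1)
    (honly : ∀ (ℓ : ℕ) [Fact ℓ.Prime], W.HasMultiplicativeReductionAtPrime ℓ → ℓ = p)
    (hlow : ∀ (K : Type) [Field K] [NumberField K] (Wd : WeierstrassCurve ℚ) [Wd.IsElliptic]
      [Wd.IsGloballyMinimal], IsImaginaryQuadratic K →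
      SatisfiesHeegnerHypothesis (W.conductorNorm ℤ) K → SatisfiesHeegnerHypothesis p K →
      (∃ C : VariableChange ℚ, C • W.quadraticTwist (NumberField.discr K : ℚ) = Wd) →
      Wd.analyticRank = 0 → MissingLowerBoundAt Wd p) :
    Typed.MissingUpperBoundAt W p := by
  haveI : NeZero (W.conductorNorm ℤ) := ⟨(W.conductorNorm_pos_holds).ne'⟩
  obtain ⟨q, hq, hle⟩ := padicValNat_shaOrder_add_le_of_rankOne_of_lowerTwists_of_jetchevAtP hGZ hKo hGZK hmod hnf
    hFH hMaz hJ W p hmult hirr hsurj hp5 hr hlow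
  have hT := padicValNat_tamagawaProduct_le_of_onlyMult W p hp5 honly
  refine ⟨q, hq, ?_⟩
  have hT' : (padicValNat p W.tamagawaProduct : ℤ) ≤
      padicValNat p ((W.baseChange ℚ_[p]).localTamagawaNumber ℤ_[p]) := by exact_mod_cast hT
  omega

end Summit.BirchSwinnertonDyer.BirchSwinnertonDyer.Theorems.JetchevAtP

end
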